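import Literature.NumberTheory.Automorphic.GLnLocalUnimodular
import Literature.NumberTheory.Automorphic.WhittakerTwistedJacquet
import Literature.NumberTheory.Automorphic.GLnGelfandKazhdanInvolution
import Literature.NumberTheory.Automorphic.TateLocalZetaShells
import Literature.NumberTheory.Automorphic.InvariantMeasureGLModUnipotent
import Literature.MeasureTheory.Group.InvariantQuotientMeasure
import HarnessLib

/-!
# Discharge of `exists_smulInvariantMeasure_glQuotUpperUnitriangular`: the invariant measure on
`GL_m(F) ⧸ U_m(F)` (Weil 1940, §9; Loomis 1953, §33D)

The named fact `exists_smulInvariantMeasure_glQuotUpperUnitriangular F` (file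
`InvariantMeasureGLModUnipotent`) asks, for every `m` and the Borel structure supplied by the
consumer, for a `GL_m(F)`-invariant Borel measure on `GL_m(F) ⧸ U_m(F)`, finite on compact sets and
positive on non-empty open sets.  It is PROVED here from Weil's existence theorem in the unimodular
case (`Literature.MeasureTheory.Group.WeilQuotient.exists_smulInvariantMeasure_quotient`: for a
closed subgroup `H` of a second countable locally compact group `G` with a right-invariant Haar
measure and inversion-invariant Haar measures on `H`, the Riesz measure of `f♭ ↦ ∫_G f`), applied to
`G = GL_m(F)` and `H = U_m(F)`:

* `GL_m(F)` is unimodular (`GLn.isMulRightInvariant_of_isHaarMeasure_local`, Getz–Hahn Cor. 3.5.2);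
* `U_m(F)` is closed (`isClosed_upperUnitriangular`) and unimodular: every element of `U_m(F)` lies
  in a compact open subgroup (`isLimitOfCompactOpen_upperUnitriangular`, Bernstein–Zelevinsky 1977
  §1.9), on which the modular character is trivial
  (`modularCharacterFun_eq_one_of_isCompact_subgroup`); hence every Haar measure of `U_m(F)` is
  right invariant (`isMulRightInvariant_of_modularCharacterFun_eq_one`) and inversion invariant
  (`isInvInvariant_of_isMulRightInvariant`).

No new definitions; standard axioms.
-/

noncomputable section

open MeasureTheory Measure Set
open scoped MatrixGroups

namespace Literature.NumberTheory.Automorphic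

variable (F : Type*) [Field F] [ValuativeRel F] [TopologicalSpace F] [IsNonarchimedeanLocalField F]

/-- `GL_m(F)` is second countable for a non-archimedean local field `F` (a subspace of
`M_m(F) × M_m(F)ᵐᵒᵖ`, `F` being second countable, `secondCountableTopology_localField`).
[folklore] -/
theorem secondCountableTopology_gl_localField (m : ℕ) : SecondCountableTopology (GL (Fin m) F) := by
  haveI := secondCountableTopology_localField F
  haveI : SecondCountableTopology (Matrix (Fin m) (Fin m) F) :=
    inferInstanceAs (SecondCountableTopology (Fin m → Fin m → F))
  haveI : SecondCountableTopology (Matrix (Fin m) (Fin m) F)ᵐᵒᵖ :=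
    MulOpposite.opHomeomorph.symm.secondCountableTopology
  exact Units.isEmbedding_embedProduct.secondCountableTopology

/-- **Every Haar measure of `U_m(F)` is inversion invariant** (`U_m(F)` is unimodular: each of its
elements lies in a compact open subgroup, `isLimitOfCompactOpen_upperUnitriangular`, where the
modular character is trivial). [cite: BernsteinZelevinskyASENS1977, §1.9] -/
theorem isInvInvariant_haar_upperUnitriangular (m : ℕ)
    [MeasurableSpace ↥(upperUnitriangular (Fin m) F)] [BorelSpace ↥(upperUnitriangular (Fin m) F)]
    (ν : Measure ↥(upperUnitriangular (Fin m) F)) [ν.IsHaarMeasure] : ν.IsInvInvariant := by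
  haveI : T2Space F := (GaloisRepresentations.IsNonarchimedeanLocalField.isLocalField F).toT2Space
  haveI : T2Space (GL (Fin m) F) := t2Space_generalLinearGroup F m
  haveI : LocallyCompactSpace (GL (Fin m) F) := locallyCompactSpace_generalLinearGroup F m
  haveI : SecondCountableTopology (GL (Fin m) F) := secondCountableTopology_gl_localField F m
  have hU : IsClosed (upperUnitriangular (Fin m) F : Set (GL (Fin m) F)) := isClosed_upperUnitriangular
  haveI : LocallyCompactSpace ↥(upperUnitriangular (Fin m) F) := hU.locallyCompactSpace
  haveI : SecondCountableTopology ↥(upperUnitriangular (Fin m) F) :=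
    TopologicalSpace.Subtype.secondCountableTopology (upperUnitriangular (Fin m) F : Set (GL (Fin m) F))
  have hΔ : ∀ u : ↥(upperUnitriangular (Fin m) F), modularCharacterFun u = 1 := by
    intro u
    obtain ⟨K, -, hKc, huK⟩ :=
      isLimitOfCompactOpen_upperUnitriangular (n := m) (F := F) {u} isCompact_singleton
    exact modularCharacterFun_eq_one_of_isCompact_subgroup hKc (huK (mem_singleton u))
  haveI : ν.IsMulRightInvariant := isMulRightInvariant_of_modularCharacterFun_eq_one hΔ ν
  exact isInvInvariant_of_isMulRightInvariant ν

/-- **The invariant measure on `GL_m(F) ⧸ U_m(F)` exists** — discharge of the named fact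
`exists_smulInvariantMeasure_glQuotUpperUnitriangular` (Weil 1940, §9; Loomis 1953, §33D): Weil's
quotient measure in the unimodular case
(`Literature.MeasureTheory.Group.WeilQuotient.exists_smulInvariantMeasure_quotient`) for the closed
unimodular subgroup `U_m(F)` of the unimodular group `GL_m(F)`. [cite: Loomis1953, §33D Theorem and §33B] -/
theorem exists_smulInvariantMeasure_glQuotUpperUnitriangular_holds :
    exists_smulInvariantMeasure_glQuotUpperUnitriangular F := by
  intro m _ _
  haveI : T2Space F := (GaloisRepresentations.IsNonarchimedeanLocalField.isLocalField F).toT2Space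
  haveI : T2Space (GL (Fin m) F) := t2Space_generalLinearGroup F m
  haveI : LocallyCompactSpace (GL (Fin m) F) := locallyCompactSpace_generalLinearGroup F m
  haveI : SecondCountableTopology (GL (Fin m) F) := secondCountableTopology_gl_localField F m
  letI : MeasurableSpace (GL (Fin m) F) := borel _
  haveI : BorelSpace (GL (Fin m) F) := ⟨rfl⟩
  letI : MeasurableSpace ↥(upperUnitriangular (Fin m) F) := borel _
  haveI : BorelSpace ↥(upperUnitriangular (Fin m) F) := ⟨rfl⟩
  have hU : IsClosed (upperUnitriangular (Fin m) F : Set (GL (Fin m) F)) := isClosed_upperUnitriangular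
  haveI : (Measure.haar : Measure (GL (Fin m) F)).IsMulRightInvariant :=
    GLn.isMulRightInvariant_of_isHaarMeasure_local m F _
  exact Literature.MeasureTheory.Group.WeilQuotient.exists_smulInvariantMeasure_quotient hU
    (fun ν hν => by haveI := hν; exact isInvInvariant_haar_upperUnitriangular F m ν)
    (Measure.haar : Measure (GL (Fin m) F))

end Literature.NumberTheory.Automorphic

end
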